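import Summits.QuantumFields.YangMills.Theorems.BalabanUVNodesN15CurvedGluingCubeSmoothCutDressed
import HarnessLib

/-!
# Route «BalabanUVNodes» (cluster K4 «SpineRates»), Track-A DAG node N15 = NE2, BACKGROUND LAYER — THE DRESSED SMOOTH-CUT CUBE's η-DEFECTS BY NAME: files 24∕25's two-grid defects run at
# `G₀ := M_{χ̃}N_□` (both grids) with every hypothesis discharged from FILE 63's cut rows, their two-grid defects, and the bumps' letters∕fits (file 31 §3): `𝔇(X′, X)` and `𝔇(∇′^±X′, ∇^±X)`
# two-sided (FILE 63∕INTENT-4 `hDGc`, FILE 58 `hIG`∕`hIDG` at a live background)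

Cell `pub-ymgap`, seat `pub-ymgap-dag-n15-w3` (WIDTH SEAT 3∕3 on node N15, director-ym №197 ∕ HUMAN RULING D-0149; plan `W-SEAT-START-LIST.md` §n15 item 3 «LG-vector + background layers at
GENERAL small-field U» — thirty-fifth piece: the two-grid twin of file 34).  `bears_on: R4∕N15 · K3⁷ SpineGivenEndpointR13SepCoPH (stmt-QuantumFields-20544)`.  Filed `--kind proof --supports
stmt-QuantumFields-20544 --as helper` — COUNT-NEUTRAL.  Theorems only; 0 `sorry`.  Imports BY NAME file 34 `…CurvedGluingCubeSmoothCutDressed` (`loc₂_le_flat`, `hasMaj_smoothCut_flat`,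
`hasMaj_jet_smoothCut_flat`, `jet_smoothCut_out`; file 31 `hasMaj_idef_smoothCut`, `hasMaj_idef_fgrad∕bgrad_smoothCut`, `smoothCut_out`, `smoothCut_in`; file 24 `hasMaj_idef_dressedV_loc₂`, file 25
`hasMaj_idef_projO_dressedV_loc₂`, file 23 `hasMaj_dressedV_pair`, `projO_some_dressedV`); nothing in the tree is modified.

WHY.  The node's statement is an η-RATE: FILE 58∕63 glue the two-grid DEFECTS of the per-cube rows (`hIG`, `hIDG`, `hDGc`).  For the dressed smooth-cut cube these are files 24∕25 at
`G₀ := M_χ̃N_□` on both grids, fed by file 31 §3's defects of the flat pieces (`m₀ + o_χβ` for `G₀`, `m₁ + o₁β₁ + c̃m₀ + o₂β` for `∇^±G₀`) weakened to ONE common bound `m̄`, exactly as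
file 34 weakened the letters to `β̄`.  THIS FILE performs that instantiation once.

* §1 `hasMaj_idef_smoothCut_flat` ∕ `hasMaj_idef_jet_smoothCut_flat` (file 31 §3 in file 24's unlocalized currency, common bound `m̄ = (m₀ + o_χβ) + (m₁ + o₁β₁ + c̃m₀ + o₂β)`);
* §2 ★★★ `hasMaj_idef_smoothCutDressed_loc₂` (`𝔇(X′, X)` two-sided), ★★ `hasMaj_idef_fgrad_smoothCutDressed_loc₂` ∕ `hasMaj_idef_bgrad_smoothCutDressed_loc₂` (`𝔇(∇′^±_μX′, ∇^±_μX)` two-sided).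

HONEST FRAMING ∕ LIMITS.  Pure instantiation over DISPLAYED rows at both grids (cut rows + their defects, bumps' letters∕insertions∕fits, input cut-offs, `V̂, V̂′` letters + fit); nothing of
[B6]∕[B9] asserted ((2.133) p.247, (3.42) p.397, (3.63)–(3.65) pp.402–403, Thm 3.14 = SHAPES ∕ MECHANISM ∕ TEMPLATE).  NE2⁺ NOT PRINTED, NOT proved; N15 NOT discharged; counts of record
UNMOVED (typed 28∕28 · discharged 5∕27); one finite 𝕋⁴ at fixed ε — NOT infinite volume, NOT OS on ℝ⁴, NOT a mass gap, NOT Clay; R4 closes the conditional finite-𝕋⁴ rung `BalabanLadder.UV` only.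
-/

set_option autoImplicit false

noncomputable section
open scoped BigOperators
open Finset

namespace Summit.QuantumFields.YangMills.BalabanUVNodes.N15.CurvedSpecies

open Literature.MathematicalPhysics.QuantumFieldTheory.Balaban1983to89
open Literature.MathematicalPhysics.QuantumFieldTheory.Balaban1983to89.B11SectG (BlockNorm HasMaj RowSum)
open Literature.MathematicalPhysics.QuantumFieldTheory.Balaban1983to89.B6RandomWalk (Triangle254)
open Literature.MathematicalPhysics.QuantumFieldTheory.Balaban1983to89.T4EtaRateDefect (idef)
open Literature.MathematicalPhysics.QuantumFieldTheory.Balaban1983to89.T4EtaRateCoeffDefect (pull)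
open Literature.MathematicalPhysics.QuantumFieldTheory.Balaban1983to89.B6Prop26Gluing (mulOp mulOp_apply ind ind_nonneg)
open Summit.QuantumFields.YangMills.BalabanUVNodes.N15.MatrixSpecies (liftBlk liftMap liftEquiv liftEquiv_apply liftEquiv_symm_apply)
open Summit.QuantumFields.YangMills.BalabanUVNodes.N15.BackgroundLayer (fgrad bgrad stack projO blkPair liftPair bgPropV projO_none_comp_stack projO_some_comp_stack)

variable {X X' ι J : Type} [Fintype X] [Fintype X'] [DecidableEq X] [DecidableEq X'] [Fintype ι] [DecidableEq ι] [Fintype J] [DecidableEq J] {g : B6.Geometry}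
  (blk : X → g.Site) (π : X' → X) (τ : J → X ≃ X) (τ' : J → X' ≃ X') (n n' : ℝ) {σ cr : ℝ}
  {N : (X × ι → ℝ) →ₗ[ℝ] (X × ι → ℝ)} {N' : (X' × ι → ℝ) →ₗ[ℝ] (X' × ι → ℝ)} {V : ((X × ι) × Option (J ⊕ J) → ℝ) →ₗ[ℝ] (X × ι → ℝ)}
  {V' : ((X' × ι) × Option (J ⊕ J) → ℝ) →ₗ[ℝ] (X' × ι → ℝ)} {χX χtX ψX : X → ℝ} {χX' χtX' ψX' : X' → ℝ} {S : Set g.Site} {β β₁ ct m₀ m₁ oχ o₁ o₂ δ : ℝ}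

/-! ## §1 File 31's defects in file 24's unlocalized currency -/

omit [DecidableEq X] [DecidableEq X'] [DecidableEq ι] [Fintype J] [DecidableEq J] in
/-- `𝔇(M_{χ̃′}N′, M_χ̃N) ≤ m̄e^{−δd}`, `m̄ = (m₀ + o_χβ) + (m₁ + o₁β₁ + c̃m₀ + o₂β)`. [cite: Balaban1985BackgroundPropagators, Thm 3.14 pp.426–427 (template)] -/
theorem hasMaj_idef_smoothCut_flat (hβ : 0 ≤ β) (hβ₁ : 0 ≤ β₁) (hct : 0 ≤ ct) (hm₀ : 0 ≤ m₀) (hm₁ : 0 ≤ m₁) (hoχ : 0 ≤ oχ) (ho₁ : 0 ≤ o₁) (ho₂ : 0 ≤ o₂)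
    (hχt' : ∀ x', |χtX' x'| ≤ 1) (hfitχ : ∀ x', |χtX' x' - χtX (π x')| ≤ oχ)
    (hsub : mulOp (fun p : X × ι => χtX p.1) ∘ₗ mulOp (fun p : X × ι => χX p.1) = mulOp (fun p : X × ι => χtX p.1))
    (hsub' : mulOp (fun p : X' × ι => χtX' p.1) ∘ₗ mulOp (fun p : X' × ι => χX' p.1) = mulOp (fun p : X' × ι => χtX' p.1))
    (hcut : HasMaj (BlockNorm.ofBlocks g (liftBlk blk ι)) (BlockNorm.ofBlocks g (liftBlk blk ι)) (mulOp (fun p : X × ι => χX p.1) ∘ₗ N)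
      (fun y y' => ind S y * ind S y' * (β * Real.exp (-(δ * g.dist y y')))))
    (hDcut : HasMaj (BlockNorm.ofBlocks g (liftBlk blk ι)) (BlockNorm.ofBlocks g (liftBlk blk ι ∘ liftMap π ι))
      (idef (pull (liftMap π ι)) (pull (liftMap π ι)) (mulOp (fun p : X' × ι => χX' p.1) ∘ₗ N') (mulOp (fun p : X × ι => χX p.1) ∘ₗ N))
      (fun y y' => ind S y * ind S y' * (m₀ * Real.exp (-(δ * g.dist y y'))))) :
    HasMaj (BlockNorm.ofBlocks g (liftBlk blk ι)) (BlockNorm.ofBlocks g (liftBlk (blk ∘ π) ι))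
      (idef (pull (liftMap π ι)) (pull (liftMap π ι)) (mulOp (fun p : X' × ι => χtX' p.1) ∘ₗ N') (mulOp (fun p : X × ι => χtX p.1) ∘ₗ N))
      (fun y y' => ((m₀ + oχ * β) + (m₁ + o₁ * β₁ + ct * m₀ + o₂ * β)) * Real.exp (-(δ * g.dist y y'))) := by
  have key := hasMaj_idef_smoothCut (liftBlk blk ι) (liftMap π ι) (N := N) (N' := N') hoχ (fun p' => hχt' p'.1) (fun p' => hfitχ p'.1) hsub hsub' hcut hDcut
  exact key.mono fun y y' => loc₂_le_flat (S := S) (by positivity) (by nlinarith) y y'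

omit [DecidableEq X] [DecidableEq X'] [DecidableEq ι] [Fintype J] [DecidableEq J] in
/-- `𝔇(∇′_j(M_{χ̃′}N′), ∇_j(M_χ̃N)) ≤ m̄e^{−δd}` for every jet index. [cite: Balaban1985BackgroundPropagators, Thm 3.14 pp.426–427 (template)] -/
theorem hasMaj_idef_jet_smoothCut_flat (hβ : 0 ≤ β) (hβ₁ : 0 ≤ β₁) (hct : 0 ≤ ct) (hm₀ : 0 ≤ m₀) (hm₁ : 0 ≤ m₁) (hoχ : 0 ≤ oχ) (ho₁ : 0 ≤ o₁) (ho₂ : 0 ≤ o₂)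
    (hχt' : ∀ x', |χtX' x'| ≤ 1)
    (hdχt' : ∀ μ p', |fgrad n' (liftEquiv (τ' μ) ι) (fun p' : X' × ι => χtX' p'.1) p'| ≤ ct) (hdχtb' : ∀ μ p', |bgrad n' (liftEquiv (τ' μ) ι) (fun p' : X' × ι => χtX' p'.1) p'| ≤ ct)
    (hfit₁ : ∀ μ p', |((fun p' : X' × ι => χtX' p'.1) ∘ (liftEquiv (τ' μ) ι)) p' - ((fun p : X × ι => χtX p.1) ∘ (liftEquiv (τ μ) ι)) (liftMap π ι p')| ≤ o₁)
    (hfit₁b : ∀ μ p', |((fun p' : X' × ι => χtX' p'.1) ∘ (liftEquiv (τ' μ) ι).symm) p' - ((fun p : X × ι => χtX p.1) ∘ (liftEquiv (τ μ) ι).symm) (liftMap π ι p')| ≤ o₁)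
    (hfit₂ : ∀ μ p', |fgrad n' (liftEquiv (τ' μ) ι) (fun p' : X' × ι => χtX' p'.1) p' - fgrad n (liftEquiv (τ μ) ι) (fun p : X × ι => χtX p.1) (liftMap π ι p')| ≤ o₂)
    (hfit₂b : ∀ μ p', |bgrad n' (liftEquiv (τ' μ) ι) (fun p' : X' × ι => χtX' p'.1) p' - bgrad n (liftEquiv (τ μ) ι) (fun p : X × ι => χtX p.1) (liftMap π ι p')| ≤ o₂)
    (hs : ∀ μ, mulOp ((fun p : X × ι => χtX p.1) ∘ (liftEquiv (τ μ) ι)) ∘ₗ mulOp (fun p : X × ι => χX p.1) = mulOp ((fun p : X × ι => χtX p.1) ∘ (liftEquiv (τ μ) ι)))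
    (hsb : ∀ μ, mulOp ((fun p : X × ι => χtX p.1) ∘ (liftEquiv (τ μ) ι).symm) ∘ₗ mulOp (fun p : X × ι => χX p.1) = mulOp ((fun p : X × ι => χtX p.1) ∘ (liftEquiv (τ μ) ι).symm))
    (hdd : ∀ μ, mulOp (fgrad n (liftEquiv (τ μ) ι) (fun p : X × ι => χtX p.1)) ∘ₗ mulOp (fun p : X × ι => χX p.1) = mulOp (fgrad n (liftEquiv (τ μ) ι) (fun p : X × ι => χtX p.1)))
    (hddb : ∀ μ, mulOp (bgrad n (liftEquiv (τ μ) ι) (fun p : X × ι => χtX p.1)) ∘ₗ mulOp (fun p : X × ι => χX p.1) = mulOp (bgrad n (liftEquiv (τ μ) ι) (fun p : X × ι => χtX p.1)))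
    (hs' : ∀ μ, mulOp ((fun p' : X' × ι => χtX' p'.1) ∘ (liftEquiv (τ' μ) ι)) ∘ₗ mulOp (fun p' : X' × ι => χX' p'.1) = mulOp ((fun p' : X' × ι => χtX' p'.1) ∘ (liftEquiv (τ' μ) ι)))
    (hsb' : ∀ μ, mulOp ((fun p' : X' × ι => χtX' p'.1) ∘ (liftEquiv (τ' μ) ι).symm) ∘ₗ mulOp (fun p' : X' × ι => χX' p'.1) =
      mulOp ((fun p' : X' × ι => χtX' p'.1) ∘ (liftEquiv (τ' μ) ι).symm))
    (hdd' : ∀ μ, mulOp (fgrad n' (liftEquiv (τ' μ) ι) (fun p' : X' × ι => χtX' p'.1)) ∘ₗ mulOp (fun p' : X' × ι => χX' p'.1) = mulOp (fgrad n' (liftEquiv (τ' μ) ι) (fun p' : X' × ι => χtX' p'.1)))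
    (hddb' : ∀ μ, mulOp (bgrad n' (liftEquiv (τ' μ) ι) (fun p' : X' × ι => χtX' p'.1)) ∘ₗ mulOp (fun p' : X' × ι => χX' p'.1) = mulOp (bgrad n' (liftEquiv (τ' μ) ι) (fun p' : X' × ι => χtX' p'.1)))
    (hcut : HasMaj (BlockNorm.ofBlocks g (liftBlk blk ι)) (BlockNorm.ofBlocks g (liftBlk blk ι)) (mulOp (fun p : X × ι => χX p.1) ∘ₗ N)
      (fun y y' => ind S y * ind S y' * (β * Real.exp (-(δ * g.dist y y')))))
    (hcutF : ∀ μ, HasMaj (BlockNorm.ofBlocks g (liftBlk blk ι)) (BlockNorm.ofBlocks g (liftBlk blk ι)) (mulOp (fun p : X × ι => χX p.1) ∘ₗ (fgrad n (liftEquiv (τ μ) ι) ∘ₗ N))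
      (fun y y' => ind S y * ind S y' * (β₁ * Real.exp (-(δ * g.dist y y')))))
    (hcutB : ∀ μ, HasMaj (BlockNorm.ofBlocks g (liftBlk blk ι)) (BlockNorm.ofBlocks g (liftBlk blk ι)) (mulOp (fun p : X × ι => χX p.1) ∘ₗ (bgrad n (liftEquiv (τ μ) ι) ∘ₗ N))
      (fun y y' => ind S y * ind S y' * (β₁ * Real.exp (-(δ * g.dist y y')))))
    (hDcut : HasMaj (BlockNorm.ofBlocks g (liftBlk blk ι)) (BlockNorm.ofBlocks g (liftBlk blk ι ∘ liftMap π ι))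
      (idef (pull (liftMap π ι)) (pull (liftMap π ι)) (mulOp (fun p : X' × ι => χX' p.1) ∘ₗ N') (mulOp (fun p : X × ι => χX p.1) ∘ₗ N))
      (fun y y' => ind S y * ind S y' * (m₀ * Real.exp (-(δ * g.dist y y')))))
    (hDcutF : ∀ μ, HasMaj (BlockNorm.ofBlocks g (liftBlk blk ι)) (BlockNorm.ofBlocks g (liftBlk blk ι ∘ liftMap π ι))
      (idef (pull (liftMap π ι)) (pull (liftMap π ι)) (mulOp (fun p : X' × ι => χX' p.1) ∘ₗ (fgrad n' (liftEquiv (τ' μ) ι) ∘ₗ N')) (mulOp (fun p : X × ι => χX p.1) ∘ₗ (fgrad n (liftEquiv (τ μ) ι) ∘ₗ N)))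
      (fun y y' => ind S y * ind S y' * (m₁ * Real.exp (-(δ * g.dist y y')))))
    (hDcutB : ∀ μ, HasMaj (BlockNorm.ofBlocks g (liftBlk blk ι)) (BlockNorm.ofBlocks g (liftBlk blk ι ∘ liftMap π ι))
      (idef (pull (liftMap π ι)) (pull (liftMap π ι)) (mulOp (fun p : X' × ι => χX' p.1) ∘ₗ (bgrad n' (liftEquiv (τ' μ) ι) ∘ₗ N')) (mulOp (fun p : X × ι => χX p.1) ∘ₗ (bgrad n (liftEquiv (τ μ) ι) ∘ₗ N)))
      (fun y y' => ind S y * ind S y' * (m₁ * Real.exp (-(δ * g.dist y y'))))) (j : J ⊕ J) :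
    HasMaj (BlockNorm.ofBlocks g (liftBlk blk ι)) (BlockNorm.ofBlocks g (liftBlk (blk ∘ π) ι))
      (idef (pull (liftMap π ι)) (pull (liftMap π ι))
        (Sum.elim (fun μ => fgrad n' (liftEquiv (τ' μ) ι)) (fun μ => bgrad n' (liftEquiv (τ' μ) ι)) j ∘ₗ (mulOp (fun p : X' × ι => χtX' p.1) ∘ₗ N'))
        (Sum.elim (fun μ => fgrad n (liftEquiv (τ μ) ι)) (fun μ => bgrad n (liftEquiv (τ μ) ι)) j ∘ₗ (mulOp (fun p : X × ι => χtX p.1) ∘ₗ N)))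
      (fun y y' => ((m₀ + oχ * β) + (m₁ + o₁ * β₁ + ct * m₀ + o₂ * β)) * Real.exp (-(δ * g.dist y y'))) := by
  have hle : m₁ + o₁ * β₁ + ct * m₀ + o₂ * β ≤ (m₀ + oχ * β) + (m₁ + o₁ * β₁ + ct * m₀ + o₂ * β) := by nlinarith
  rcases j with μ | μ
  · simp only [Sum.elim_inl]
    have key := hasMaj_idef_fgrad_smoothCut (liftBlk blk ι) (liftMap π ι) n n' (liftEquiv (τ μ) ι) (liftEquiv (τ' μ) ι) (N := N) (N' := N') hct ho₁ ho₂
      (fun p' => by simp only [Function.comp_apply, liftEquiv_apply]; exact hχt' _) (hdχt' μ) (hfit₁ μ) (hfit₂ μ) (hs μ) (hdd μ) (hs' μ) (hdd' μ) hcut (hcutF μ) hDcut (hDcutF μ)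
    exact key.mono fun y y' => loc₂_le_flat (S := S) (by positivity) hle y y'
  · simp only [Sum.elim_inr]
    have key := hasMaj_idef_bgrad_smoothCut (liftBlk blk ι) (liftMap π ι) n n' (liftEquiv (τ μ) ι) (liftEquiv (τ' μ) ι) (N := N) (N' := N') hct ho₁ ho₂
      (fun p' => by simp only [Function.comp_apply, liftEquiv_symm_apply]; exact hχt' _) (hdχtb' μ) (hfit₁b μ) (hfit₂b μ) (hsb μ) (hddb μ) (hsb' μ) (hddb' μ) hcut (hcutB μ) hDcut (hDcutB μ)
    exact key.mono fun y y' => loc₂_le_flat (S := S) (by positivity) hle y y'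

/-! ## §2 The dressed smooth-cut cube's two-grid defects, two-sided -/

/-- THE COMMON HYPOTHESIS BUNDLE is long; abbreviations in the docstrings: «coarse bump data» = `|χ̃| ≤ 1`, `|∇^±χ̃| ≤ c̃`, the six support insertions; «fine bump data» = the same primed;
«cut rows» = `M_χN ≤ 1_S1_S·β`, `M_χ∇^±N ≤ 1_S1_S·β₁` (both grids) and their defects `m₀, m₁`; «fits» = `o_χ, o₁, o₂` of the bumps across `π`.

★★★ **THE TWO-GRID DEFECT OF ENTRY 0 OF THE DRESSED SMOOTH-CUT CUBE, TWO-SIDED** (FILE 63∕file 32 `hDGc`, FILE 58 `hIG` at a live background): from the cut rows + defects of `N_□, N′_□`, coarse and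
fine bump data + fits, input cut-offs `N = NM_ψ`, `N′ = N′M_{ψ′}`, the perturbations `V̂, V̂′ ≤ Re^{−δ_Vd}` with fit `𝔇(V̂′, V̂) ≤ oe^{−δ_Vd}`, ONE smallness `β̄Rc_r² < 1`:
`𝔇(X′, X) ≤ 1_S1_S·C(β̄, m̄, R, o, c_r)·e^{−ρ₂d}` with file 24's constant at `β := β̄`, `m_G := m̄`. [cite: Balaban1985BackgroundPropagators, Thm 3.14 pp.426–427 (template); Balaban1984PropagatorsII, (2.133) p.247 (shape)] -/
theorem hasMaj_idef_smoothCutDressed_loc₂ (htri : Triangle254 g) (hd : ∀ a b : g.Site, 0 ≤ g.dist a b) (hrow : RowSum g σ cr) (hσ : 0 ≤ σ) (hcr : 0 ≤ cr) {ρ₁ ρ₂ δV R o : ℝ}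
    (hβ : 0 ≤ β) (hβ₁ : 0 ≤ β₁) (hct : 0 ≤ ct) (hm₀ : 0 ≤ m₀) (hm₁ : 0 ≤ m₁) (hoχ : 0 ≤ oχ) (ho₁ : 0 ≤ o₁) (ho₂ : 0 ≤ o₂) (hR : 0 ≤ R) (ho : 0 ≤ o) (hσρ : σ ≤ ρ₁)
    (hρ₁V : ρ₁ ≤ δV) (hρ₁G : ρ₁ + σ ≤ δ) (hρ₂ : 0 ≤ ρ₂) (hρ₂₁ : ρ₂ + σ ≤ ρ₁)
    -- supports of the cuts over `S`, both grids
    (hSχ : ∀ x, χX x ≠ 0 → blk x ∈ S) (hSψ : ∀ x, ψX x ≠ 0 → blk x ∈ S) (hSχ' : ∀ x', χX' x' ≠ 0 → blk (π x') ∈ S) (hSψ' : ∀ x', ψX' x' ≠ 0 → blk (π x') ∈ S)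
    -- coarse bump data
    (hχt : ∀ x, |χtX x| ≤ 1)
    (hdχt : ∀ μ p, |fgrad n (liftEquiv (τ μ) ι) (fun p : X × ι => χtX p.1) p| ≤ ct) (hdχtb : ∀ μ p, |bgrad n (liftEquiv (τ μ) ι) (fun p : X × ι => χtX p.1) p| ≤ ct)
    (hsub : mulOp (fun p : X × ι => χtX p.1) ∘ₗ mulOp (fun p : X × ι => χX p.1) = mulOp (fun p : X × ι => χtX p.1))
    (hχ : mulOp (fun p : X × ι => χX p.1) ∘ₗ mulOp (fun p : X × ι => χtX p.1) = mulOp (fun p : X × ι => χtX p.1))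
    (hs : ∀ μ, mulOp ((fun p : X × ι => χtX p.1) ∘ (liftEquiv (τ μ) ι)) ∘ₗ mulOp (fun p : X × ι => χX p.1) = mulOp ((fun p : X × ι => χtX p.1) ∘ (liftEquiv (τ μ) ι)))
    (hsb : ∀ μ, mulOp ((fun p : X × ι => χtX p.1) ∘ (liftEquiv (τ μ) ι).symm) ∘ₗ mulOp (fun p : X × ι => χX p.1) = mulOp ((fun p : X × ι => χtX p.1) ∘ (liftEquiv (τ μ) ι).symm))
    (hdd : ∀ μ, mulOp (fgrad n (liftEquiv (τ μ) ι) (fun p : X × ι => χtX p.1)) ∘ₗ mulOp (fun p : X × ι => χX p.1) = mulOp (fgrad n (liftEquiv (τ μ) ι) (fun p : X × ι => χtX p.1)))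
    (hddb : ∀ μ, mulOp (bgrad n (liftEquiv (τ μ) ι) (fun p : X × ι => χtX p.1)) ∘ₗ mulOp (fun p : X × ι => χX p.1) = mulOp (bgrad n (liftEquiv (τ μ) ι) (fun p : X × ι => χtX p.1)))
    (hNψ : N ∘ₗ mulOp (fun p : X × ι => ψX p.1) = N)
    -- fine bump data
    (hχt' : ∀ x', |χtX' x'| ≤ 1)
    (hdχt' : ∀ μ p', |fgrad n' (liftEquiv (τ' μ) ι) (fun p' : X' × ι => χtX' p'.1) p'| ≤ ct) (hdχtb' : ∀ μ p', |bgrad n' (liftEquiv (τ' μ) ι) (fun p' : X' × ι => χtX' p'.1) p'| ≤ ct)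
    (hsub' : mulOp (fun p : X' × ι => χtX' p.1) ∘ₗ mulOp (fun p : X' × ι => χX' p.1) = mulOp (fun p : X' × ι => χtX' p.1))
    (hχ' : mulOp (fun p : X' × ι => χX' p.1) ∘ₗ mulOp (fun p : X' × ι => χtX' p.1) = mulOp (fun p : X' × ι => χtX' p.1))
    (hs' : ∀ μ, mulOp ((fun p' : X' × ι => χtX' p'.1) ∘ (liftEquiv (τ' μ) ι)) ∘ₗ mulOp (fun p' : X' × ι => χX' p'.1) = mulOp ((fun p' : X' × ι => χtX' p'.1) ∘ (liftEquiv (τ' μ) ι)))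
    (hsb' : ∀ μ, mulOp ((fun p' : X' × ι => χtX' p'.1) ∘ (liftEquiv (τ' μ) ι).symm) ∘ₗ mulOp (fun p' : X' × ι => χX' p'.1) =
      mulOp ((fun p' : X' × ι => χtX' p'.1) ∘ (liftEquiv (τ' μ) ι).symm))
    (hdd' : ∀ μ, mulOp (fgrad n' (liftEquiv (τ' μ) ι) (fun p' : X' × ι => χtX' p'.1)) ∘ₗ mulOp (fun p' : X' × ι => χX' p'.1) = mulOp (fgrad n' (liftEquiv (τ' μ) ι) (fun p' : X' × ι => χtX' p'.1)))
    (hddb' : ∀ μ, mulOp (bgrad n' (liftEquiv (τ' μ) ι) (fun p' : X' × ι => χtX' p'.1)) ∘ₗ mulOp (fun p' : X' × ι => χX' p'.1) = mulOp (bgrad n' (liftEquiv (τ' μ) ι) (fun p' : X' × ι => χtX' p'.1)))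
    (hNψ' : N' ∘ₗ mulOp (fun p : X' × ι => ψX' p.1) = N')
    -- fits of the bumps across `π`
    (hfitχ : ∀ x', |χtX' x' - χtX (π x')| ≤ oχ)
    (hfit₁ : ∀ μ p', |((fun p' : X' × ι => χtX' p'.1) ∘ (liftEquiv (τ' μ) ι)) p' - ((fun p : X × ι => χtX p.1) ∘ (liftEquiv (τ μ) ι)) (liftMap π ι p')| ≤ o₁)
    (hfit₁b : ∀ μ p', |((fun p' : X' × ι => χtX' p'.1) ∘ (liftEquiv (τ' μ) ι).symm) p' - ((fun p : X × ι => χtX p.1) ∘ (liftEquiv (τ μ) ι).symm) (liftMap π ι p')| ≤ o₁)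
    (hfit₂ : ∀ μ p', |fgrad n' (liftEquiv (τ' μ) ι) (fun p' : X' × ι => χtX' p'.1) p' - fgrad n (liftEquiv (τ μ) ι) (fun p : X × ι => χtX p.1) (liftMap π ι p')| ≤ o₂)
    (hfit₂b : ∀ μ p', |bgrad n' (liftEquiv (τ' μ) ι) (fun p' : X' × ι => χtX' p'.1) p' - bgrad n (liftEquiv (τ μ) ι) (fun p : X × ι => χtX p.1) (liftMap π ι p')| ≤ o₂)
    -- cut rows and their defects
    (hcut : HasMaj (BlockNorm.ofBlocks g (liftBlk blk ι)) (BlockNorm.ofBlocks g (liftBlk blk ι)) (mulOp (fun p : X × ι => χX p.1) ∘ₗ N)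
      (fun y y' => ind S y * ind S y' * (β * Real.exp (-(δ * g.dist y y')))))
    (hcutF : ∀ μ, HasMaj (BlockNorm.ofBlocks g (liftBlk blk ι)) (BlockNorm.ofBlocks g (liftBlk blk ι)) (mulOp (fun p : X × ι => χX p.1) ∘ₗ (fgrad n (liftEquiv (τ μ) ι) ∘ₗ N))
      (fun y y' => ind S y * ind S y' * (β₁ * Real.exp (-(δ * g.dist y y')))))
    (hcutB : ∀ μ, HasMaj (BlockNorm.ofBlocks g (liftBlk blk ι)) (BlockNorm.ofBlocks g (liftBlk blk ι)) (mulOp (fun p : X × ι => χX p.1) ∘ₗ (bgrad n (liftEquiv (τ μ) ι) ∘ₗ N))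
      (fun y y' => ind S y * ind S y' * (β₁ * Real.exp (-(δ * g.dist y y')))))
    (hcut' : HasMaj (BlockNorm.ofBlocks g (liftBlk (blk ∘ π) ι)) (BlockNorm.ofBlocks g (liftBlk (blk ∘ π) ι)) (mulOp (fun p : X' × ι => χX' p.1) ∘ₗ N')
      (fun y y' => ind S y * ind S y' * (β * Real.exp (-(δ * g.dist y y')))))
    (hcutF' : ∀ μ, HasMaj (BlockNorm.ofBlocks g (liftBlk (blk ∘ π) ι)) (BlockNorm.ofBlocks g (liftBlk (blk ∘ π) ι)) (mulOp (fun p : X' × ι => χX' p.1) ∘ₗ (fgrad n' (liftEquiv (τ' μ) ι) ∘ₗ N'))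
      (fun y y' => ind S y * ind S y' * (β₁ * Real.exp (-(δ * g.dist y y')))))
    (hcutB' : ∀ μ, HasMaj (BlockNorm.ofBlocks g (liftBlk (blk ∘ π) ι)) (BlockNorm.ofBlocks g (liftBlk (blk ∘ π) ι)) (mulOp (fun p : X' × ι => χX' p.1) ∘ₗ (bgrad n' (liftEquiv (τ' μ) ι) ∘ₗ N'))
      (fun y y' => ind S y * ind S y' * (β₁ * Real.exp (-(δ * g.dist y y')))))
    (hDcut : HasMaj (BlockNorm.ofBlocks g (liftBlk blk ι)) (BlockNorm.ofBlocks g (liftBlk blk ι ∘ liftMap π ι))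
      (idef (pull (liftMap π ι)) (pull (liftMap π ι)) (mulOp (fun p : X' × ι => χX' p.1) ∘ₗ N') (mulOp (fun p : X × ι => χX p.1) ∘ₗ N))
      (fun y y' => ind S y * ind S y' * (m₀ * Real.exp (-(δ * g.dist y y')))))
    (hDcutF : ∀ μ, HasMaj (BlockNorm.ofBlocks g (liftBlk blk ι)) (BlockNorm.ofBlocks g (liftBlk blk ι ∘ liftMap π ι))
      (idef (pull (liftMap π ι)) (pull (liftMap π ι)) (mulOp (fun p : X' × ι => χX' p.1) ∘ₗ (fgrad n' (liftEquiv (τ' μ) ι) ∘ₗ N')) (mulOp (fun p : X × ι => χX p.1) ∘ₗ (fgrad n (liftEquiv (τ μ) ι) ∘ₗ N)))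
      (fun y y' => ind S y * ind S y' * (m₁ * Real.exp (-(δ * g.dist y y')))))
    (hDcutB : ∀ μ, HasMaj (BlockNorm.ofBlocks g (liftBlk blk ι)) (BlockNorm.ofBlocks g (liftBlk blk ι ∘ liftMap π ι))
      (idef (pull (liftMap π ι)) (pull (liftMap π ι)) (mulOp (fun p : X' × ι => χX' p.1) ∘ₗ (bgrad n' (liftEquiv (τ' μ) ι) ∘ₗ N')) (mulOp (fun p : X × ι => χX p.1) ∘ₗ (bgrad n (liftEquiv (τ μ) ι) ∘ₗ N)))
      (fun y y' => ind S y * ind S y' * (m₁ * Real.exp (-(δ * g.dist y y')))))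
    -- the perturbation at both grids
    (hV : HasMaj (BlockNorm.ofBlocks g (blkPair (liftBlk blk ι))) (BlockNorm.ofBlocks g (liftBlk blk ι)) V (fun y y' => R * Real.exp (-(δV * g.dist y y'))))
    (hV' : HasMaj (BlockNorm.ofBlocks g (blkPair (liftBlk (blk ∘ π) ι))) (BlockNorm.ofBlocks g (liftBlk (blk ∘ π) ι)) V' (fun y y' => R * Real.exp (-(δV * g.dist y y'))))
    (hDV : HasMaj (BlockNorm.ofBlocks g (blkPair (liftBlk blk ι))) (BlockNorm.ofBlocks g (liftBlk (blk ∘ π) ι))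
      (idef (pull (liftPair (liftMap π ι))) (pull (liftMap π ι)) V' V) (fun y y' => o * Real.exp (-(δV * g.dist y y'))))
    (hq : (β + (β₁ + ct * β)) * (R * cr) * cr < 1) :
    HasMaj (BlockNorm.ofBlocks g (liftBlk blk ι)) (BlockNorm.ofBlocks g (liftBlk (blk ∘ π) ι))
      (idef (pull (liftMap π ι)) (pull (liftMap π ι))
        (projO none ∘ₗ bgPropV (stack (mulOp (fun p : X' × ι => χtX' p.1) ∘ₗ N')
          (fun j => Sum.elim (fun μ => fgrad n' (liftEquiv (τ' μ) ι)) (fun μ => bgrad n' (liftEquiv (τ' μ) ι)) j ∘ₗ (mulOp (fun p : X' × ι => χtX' p.1) ∘ₗ N'))) V')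
        (projO none ∘ₗ bgPropV (stack (mulOp (fun p : X × ι => χtX p.1) ∘ₗ N)
          (fun j => Sum.elim (fun μ => fgrad n (liftEquiv (τ μ) ι)) (fun μ => bgrad n (liftEquiv (τ μ) ι)) j ∘ₗ (mulOp (fun p : X × ι => χtX p.1) ∘ₗ N))) V))
      (fun y y' => ind S y * ind S y' *
        ((((m₀ + oχ * β) + (m₁ + o₁ * β₁ + ct * m₀ + o₂ * β)) * cr +
              1 * (((m₀ + oχ * β) + (m₁ + o₁ * β₁ + ct * m₀ + o₂ * β)) * cr) * (R * ((β + (β₁ + ct * β)) * (1 - (β + (β₁ + ct * β)) * (R * cr) * cr)⁻¹) * cr) +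
            (β + (β₁ + ct * β)) * o * cr * ((β + (β₁ + ct * β)) * (1 - (β + (β₁ + ct * β)) * (R * cr) * cr)⁻¹) * cr) *
          (1 - 1 * ((β + (β₁ + ct * β)) * (R * cr) * cr))⁻¹ * Real.exp (-(ρ₂ * g.dist y y')))) := by
  have hβb : 0 ≤ β + (β₁ + ct * β) := by positivity
  have hmb : 0 ≤ (m₀ + oχ * β) + (m₁ + o₁ * β₁ + ct * m₀ + o₂ * β) := by positivity
  have hG := hasMaj_smoothCut_flat blk (S := S) hβ hβ₁ hct hχt hsub hcut
  have hD := hasMaj_jet_smoothCut_flat blk τ n (S := S) hβ hβ₁ hct hχt hdχt hdχtb hs hsb hdd hddb hcut hcutF hcutB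
  have hG' := hasMaj_smoothCut_flat (blk ∘ π) (S := S) hβ hβ₁ hct hχt' hsub' hcut'
  have hD' := hasMaj_jet_smoothCut_flat (blk ∘ π) τ' n' (S := S) hβ hβ₁ hct hχt' hdχt' hdχtb' hs' hsb' hdd' hddb' hcut' hcutF' hcutB'
  have hDG := hasMaj_idef_smoothCut_flat blk π (S := S) (N := N) (N' := N') hβ hβ₁ hct hm₀ hm₁ hoχ ho₁ ho₂ hχt' hfitχ hsub hsub' hcut hDcut
  have hDD := hasMaj_idef_jet_smoothCut_flat blk π τ τ' n n' (S := S) (N := N) (N' := N') hβ hβ₁ hct hm₀ hm₁ hoχ ho₁ ho₂ hχt' hdχt' hdχtb' hfit₁ hfit₁b hfit₂ hfit₂b hs hsb hdd hddb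
    hs' hsb' hdd' hddb' hcut hcutF hcutB hDcut hDcutF hDcutB
  exact hasMaj_idef_dressedV_loc₂ blk π htri hd hrow hσ hcr hβb hR ho hmb hσρ hρ₁V hρ₁G hρ₂ hρ₂₁ (fun _ => rfl) (fun _ => rfl) hSχ hSψ hSχ' hSψ' (smoothCut_out hχ) (smoothCut_in hNψ)
    (smoothCut_out hχ') (smoothCut_in hNψ') hG hD hG' hD' hDG hDD hV hV' hDV hq


/-- ★★ **THE TWO-GRID DEFECTS OF THE LEFT ENTRIES OF THE DRESSED SMOOTH-CUT CUBE, TWO-SIDED** (FILE 58 `hIDG` for `D := ∇^±_μ`): ★★★'s hypotheses plus the jet pieces' reversed insertions at both grids ⟹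
`𝔇(∇′_jX′, ∇_jX) ≤ 1_S1_S·C(β̄, m̄, R, o, c_r)·e^{−ρ₂d}` for every jet index `j = ±μ` (file 25 + file 23 `projO_some_dressedV` at both grids).
[cite: Balaban1985BackgroundPropagators, (3.42) p.397 (entry 1), Thm 3.14 pp.426–427 (template); Balaban1984PropagatorsII, (2.133) p.247] -/
theorem hasMaj_idef_jet_smoothCutDressed_loc₂ (htri : Triangle254 g) (hd : ∀ a b : g.Site, 0 ≤ g.dist a b) (hrow : RowSum g σ cr) (hσ : 0 ≤ σ) (hcr : 0 ≤ cr) {ρ₁ ρ₂ δV R o : ℝ}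
    (hβ : 0 ≤ β) (hβ₁ : 0 ≤ β₁) (hct : 0 ≤ ct) (hm₀ : 0 ≤ m₀) (hm₁ : 0 ≤ m₁) (hoχ : 0 ≤ oχ) (ho₁ : 0 ≤ o₁) (ho₂ : 0 ≤ o₂) (hR : 0 ≤ R) (ho : 0 ≤ o) (hσρ : σ ≤ ρ₁)
    (hρ₁V : ρ₁ ≤ δV) (hρ₁G : ρ₁ + σ ≤ δ) (hρ₂ : 0 ≤ ρ₂) (hρ₂₁ : ρ₂ + σ ≤ ρ₁)
    -- supports of the cuts over `S`, both grids
    (hSχ : ∀ x, χX x ≠ 0 → blk x ∈ S) (hSψ : ∀ x, ψX x ≠ 0 → blk x ∈ S) (hSχ' : ∀ x', χX' x' ≠ 0 → blk (π x') ∈ S) (hSψ' : ∀ x', ψX' x' ≠ 0 → blk (π x') ∈ S)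
    -- coarse bump data
    (hχt : ∀ x, |χtX x| ≤ 1)
    (hdχt : ∀ μ p, |fgrad n (liftEquiv (τ μ) ι) (fun p : X × ι => χtX p.1) p| ≤ ct) (hdχtb : ∀ μ p, |bgrad n (liftEquiv (τ μ) ι) (fun p : X × ι => χtX p.1) p| ≤ ct)
    (hsub : mulOp (fun p : X × ι => χtX p.1) ∘ₗ mulOp (fun p : X × ι => χX p.1) = mulOp (fun p : X × ι => χtX p.1))
    (hs : ∀ μ, mulOp ((fun p : X × ι => χtX p.1) ∘ (liftEquiv (τ μ) ι)) ∘ₗ mulOp (fun p : X × ι => χX p.1) = mulOp ((fun p : X × ι => χtX p.1) ∘ (liftEquiv (τ μ) ι)))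
    (hsb : ∀ μ, mulOp ((fun p : X × ι => χtX p.1) ∘ (liftEquiv (τ μ) ι).symm) ∘ₗ mulOp (fun p : X × ι => χX p.1) = mulOp ((fun p : X × ι => χtX p.1) ∘ (liftEquiv (τ μ) ι).symm))
    (hdd : ∀ μ, mulOp (fgrad n (liftEquiv (τ μ) ι) (fun p : X × ι => χtX p.1)) ∘ₗ mulOp (fun p : X × ι => χX p.1) = mulOp (fgrad n (liftEquiv (τ μ) ι) (fun p : X × ι => χtX p.1)))
    (hddb : ∀ μ, mulOp (bgrad n (liftEquiv (τ μ) ι) (fun p : X × ι => χtX p.1)) ∘ₗ mulOp (fun p : X × ι => χX p.1) = mulOp (bgrad n (liftEquiv (τ μ) ι) (fun p : X × ι => χtX p.1)))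
    (hNψ : N ∘ₗ mulOp (fun p : X × ι => ψX p.1) = N)
    -- fine bump data
    (hχt' : ∀ x', |χtX' x'| ≤ 1)
    (hdχt' : ∀ μ p', |fgrad n' (liftEquiv (τ' μ) ι) (fun p' : X' × ι => χtX' p'.1) p'| ≤ ct) (hdχtb' : ∀ μ p', |bgrad n' (liftEquiv (τ' μ) ι) (fun p' : X' × ι => χtX' p'.1) p'| ≤ ct)
    (hsub' : mulOp (fun p : X' × ι => χtX' p.1) ∘ₗ mulOp (fun p : X' × ι => χX' p.1) = mulOp (fun p : X' × ι => χtX' p.1))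
    (hs' : ∀ μ, mulOp ((fun p' : X' × ι => χtX' p'.1) ∘ (liftEquiv (τ' μ) ι)) ∘ₗ mulOp (fun p' : X' × ι => χX' p'.1) = mulOp ((fun p' : X' × ι => χtX' p'.1) ∘ (liftEquiv (τ' μ) ι)))
    (hsb' : ∀ μ, mulOp ((fun p' : X' × ι => χtX' p'.1) ∘ (liftEquiv (τ' μ) ι).symm) ∘ₗ mulOp (fun p' : X' × ι => χX' p'.1) =
      mulOp ((fun p' : X' × ι => χtX' p'.1) ∘ (liftEquiv (τ' μ) ι).symm))
    (hdd' : ∀ μ, mulOp (fgrad n' (liftEquiv (τ' μ) ι) (fun p' : X' × ι => χtX' p'.1)) ∘ₗ mulOp (fun p' : X' × ι => χX' p'.1) = mulOp (fgrad n' (liftEquiv (τ' μ) ι) (fun p' : X' × ι => χtX' p'.1)))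
    (hddb' : ∀ μ, mulOp (bgrad n' (liftEquiv (τ' μ) ι) (fun p' : X' × ι => χtX' p'.1)) ∘ₗ mulOp (fun p' : X' × ι => χX' p'.1) = mulOp (bgrad n' (liftEquiv (τ' μ) ι) (fun p' : X' × ι => χtX' p'.1)))
    (hNψ' : N' ∘ₗ mulOp (fun p : X' × ι => ψX' p.1) = N')
    -- fits of the bumps across `π`
    (hfitχ : ∀ x', |χtX' x' - χtX (π x')| ≤ oχ)
    (hfit₁ : ∀ μ p', |((fun p' : X' × ι => χtX' p'.1) ∘ (liftEquiv (τ' μ) ι)) p' - ((fun p : X × ι => χtX p.1) ∘ (liftEquiv (τ μ) ι)) (liftMap π ι p')| ≤ o₁)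
    (hfit₁b : ∀ μ p', |((fun p' : X' × ι => χtX' p'.1) ∘ (liftEquiv (τ' μ) ι).symm) p' - ((fun p : X × ι => χtX p.1) ∘ (liftEquiv (τ μ) ι).symm) (liftMap π ι p')| ≤ o₁)
    (hfit₂ : ∀ μ p', |fgrad n' (liftEquiv (τ' μ) ι) (fun p' : X' × ι => χtX' p'.1) p' - fgrad n (liftEquiv (τ μ) ι) (fun p : X × ι => χtX p.1) (liftMap π ι p')| ≤ o₂)
    (hfit₂b : ∀ μ p', |bgrad n' (liftEquiv (τ' μ) ι) (fun p' : X' × ι => χtX' p'.1) p' - bgrad n (liftEquiv (τ μ) ι) (fun p : X × ι => χtX p.1) (liftMap π ι p')| ≤ o₂)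
    -- cut rows and their defects
    (hcut : HasMaj (BlockNorm.ofBlocks g (liftBlk blk ι)) (BlockNorm.ofBlocks g (liftBlk blk ι)) (mulOp (fun p : X × ι => χX p.1) ∘ₗ N)
      (fun y y' => ind S y * ind S y' * (β * Real.exp (-(δ * g.dist y y')))))
    (hcutF : ∀ μ, HasMaj (BlockNorm.ofBlocks g (liftBlk blk ι)) (BlockNorm.ofBlocks g (liftBlk blk ι)) (mulOp (fun p : X × ι => χX p.1) ∘ₗ (fgrad n (liftEquiv (τ μ) ι) ∘ₗ N))
      (fun y y' => ind S y * ind S y' * (β₁ * Real.exp (-(δ * g.dist y y')))))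
    (hcutB : ∀ μ, HasMaj (BlockNorm.ofBlocks g (liftBlk blk ι)) (BlockNorm.ofBlocks g (liftBlk blk ι)) (mulOp (fun p : X × ι => χX p.1) ∘ₗ (bgrad n (liftEquiv (τ μ) ι) ∘ₗ N))
      (fun y y' => ind S y * ind S y' * (β₁ * Real.exp (-(δ * g.dist y y')))))
    (hcut' : HasMaj (BlockNorm.ofBlocks g (liftBlk (blk ∘ π) ι)) (BlockNorm.ofBlocks g (liftBlk (blk ∘ π) ι)) (mulOp (fun p : X' × ι => χX' p.1) ∘ₗ N')
      (fun y y' => ind S y * ind S y' * (β * Real.exp (-(δ * g.dist y y')))))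
    (hcutF' : ∀ μ, HasMaj (BlockNorm.ofBlocks g (liftBlk (blk ∘ π) ι)) (BlockNorm.ofBlocks g (liftBlk (blk ∘ π) ι)) (mulOp (fun p : X' × ι => χX' p.1) ∘ₗ (fgrad n' (liftEquiv (τ' μ) ι) ∘ₗ N'))
      (fun y y' => ind S y * ind S y' * (β₁ * Real.exp (-(δ * g.dist y y')))))
    (hcutB' : ∀ μ, HasMaj (BlockNorm.ofBlocks g (liftBlk (blk ∘ π) ι)) (BlockNorm.ofBlocks g (liftBlk (blk ∘ π) ι)) (mulOp (fun p : X' × ι => χX' p.1) ∘ₗ (bgrad n' (liftEquiv (τ' μ) ι) ∘ₗ N'))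
      (fun y y' => ind S y * ind S y' * (β₁ * Real.exp (-(δ * g.dist y y')))))
    (hDcut : HasMaj (BlockNorm.ofBlocks g (liftBlk blk ι)) (BlockNorm.ofBlocks g (liftBlk blk ι ∘ liftMap π ι))
      (idef (pull (liftMap π ι)) (pull (liftMap π ι)) (mulOp (fun p : X' × ι => χX' p.1) ∘ₗ N') (mulOp (fun p : X × ι => χX p.1) ∘ₗ N))
      (fun y y' => ind S y * ind S y' * (m₀ * Real.exp (-(δ * g.dist y y')))))
    (hDcutF : ∀ μ, HasMaj (BlockNorm.ofBlocks g (liftBlk blk ι)) (BlockNorm.ofBlocks g (liftBlk blk ι ∘ liftMap π ι))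
      (idef (pull (liftMap π ι)) (pull (liftMap π ι)) (mulOp (fun p : X' × ι => χX' p.1) ∘ₗ (fgrad n' (liftEquiv (τ' μ) ι) ∘ₗ N')) (mulOp (fun p : X × ι => χX p.1) ∘ₗ (fgrad n (liftEquiv (τ μ) ι) ∘ₗ N)))
      (fun y y' => ind S y * ind S y' * (m₁ * Real.exp (-(δ * g.dist y y')))))
    (hDcutB : ∀ μ, HasMaj (BlockNorm.ofBlocks g (liftBlk blk ι)) (BlockNorm.ofBlocks g (liftBlk blk ι ∘ liftMap π ι))
      (idef (pull (liftMap π ι)) (pull (liftMap π ι)) (mulOp (fun p : X' × ι => χX' p.1) ∘ₗ (bgrad n' (liftEquiv (τ' μ) ι) ∘ₗ N')) (mulOp (fun p : X × ι => χX p.1) ∘ₗ (bgrad n (liftEquiv (τ μ) ι) ∘ₗ N)))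
      (fun y y' => ind S y * ind S y' * (m₁ * Real.exp (-(δ * g.dist y y')))))
    -- the perturbation at both grids
    (hV : HasMaj (BlockNorm.ofBlocks g (blkPair (liftBlk blk ι))) (BlockNorm.ofBlocks g (liftBlk blk ι)) V (fun y y' => R * Real.exp (-(δV * g.dist y y'))))
    (hV' : HasMaj (BlockNorm.ofBlocks g (blkPair (liftBlk (blk ∘ π) ι))) (BlockNorm.ofBlocks g (liftBlk (blk ∘ π) ι)) V' (fun y y' => R * Real.exp (-(δV * g.dist y y'))))
    (hDV : HasMaj (BlockNorm.ofBlocks g (blkPair (liftBlk blk ι))) (BlockNorm.ofBlocks g (liftBlk (blk ∘ π) ι))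
      (idef (pull (liftPair (liftMap π ι))) (pull (liftMap π ι)) V' V) (fun y y' => o * Real.exp (-(δV * g.dist y y'))))
    -- the jet pieces' reversed insertions (output cut-offs), both grids
    (hs2 : ∀ μ, mulOp (fun p : X × ι => χX p.1) ∘ₗ mulOp ((fun p : X × ι => χtX p.1) ∘ (liftEquiv (τ μ) ι)) = mulOp ((fun p : X × ι => χtX p.1) ∘ (liftEquiv (τ μ) ι)))
    (hsb2 : ∀ μ, mulOp (fun p : X × ι => χX p.1) ∘ₗ mulOp ((fun p : X × ι => χtX p.1) ∘ (liftEquiv (τ μ) ι).symm) = mulOp ((fun p : X × ι => χtX p.1) ∘ (liftEquiv (τ μ) ι).symm))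
    (hdd2 : ∀ μ, mulOp (fun p : X × ι => χX p.1) ∘ₗ mulOp (fgrad n (liftEquiv (τ μ) ι) (fun p : X × ι => χtX p.1)) = mulOp (fgrad n (liftEquiv (τ μ) ι) (fun p : X × ι => χtX p.1)))
    (hddb2 : ∀ μ, mulOp (fun p : X × ι => χX p.1) ∘ₗ mulOp (bgrad n (liftEquiv (τ μ) ι) (fun p : X × ι => χtX p.1)) = mulOp (bgrad n (liftEquiv (τ μ) ι) (fun p : X × ι => χtX p.1)))
    (hs2' : ∀ μ, mulOp (fun p' : X' × ι => χX' p'.1) ∘ₗ mulOp ((fun p' : X' × ι => χtX' p'.1) ∘ (liftEquiv (τ' μ) ι)) = mulOp ((fun p' : X' × ι => χtX' p'.1) ∘ (liftEquiv (τ' μ) ι)))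
    (hsb2' : ∀ μ, mulOp (fun p' : X' × ι => χX' p'.1) ∘ₗ mulOp ((fun p' : X' × ι => χtX' p'.1) ∘ (liftEquiv (τ' μ) ι).symm) =
      mulOp ((fun p' : X' × ι => χtX' p'.1) ∘ (liftEquiv (τ' μ) ι).symm))
    (hdd2' : ∀ μ, mulOp (fun p' : X' × ι => χX' p'.1) ∘ₗ mulOp (fgrad n' (liftEquiv (τ' μ) ι) (fun p' : X' × ι => χtX' p'.1)) = mulOp (fgrad n' (liftEquiv (τ' μ) ι) (fun p' : X' × ι => χtX' p'.1)))
    (hddb2' : ∀ μ, mulOp (fun p' : X' × ι => χX' p'.1) ∘ₗ mulOp (bgrad n' (liftEquiv (τ' μ) ι) (fun p' : X' × ι => χtX' p'.1)) = mulOp (bgrad n' (liftEquiv (τ' μ) ι) (fun p' : X' × ι => χtX' p'.1)))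
    (hq : (β + (β₁ + ct * β)) * (R * cr) * cr < 1) (j : J ⊕ J) :
    HasMaj (BlockNorm.ofBlocks g (liftBlk blk ι)) (BlockNorm.ofBlocks g (liftBlk (blk ∘ π) ι))
      (idef (pull (liftMap π ι)) (pull (liftMap π ι))
        (Sum.elim (fun μ => fgrad n' (liftEquiv (τ' μ) ι)) (fun μ => bgrad n' (liftEquiv (τ' μ) ι)) j ∘ₗ
          (projO none ∘ₗ bgPropV (stack (mulOp (fun p : X' × ι => χtX' p.1) ∘ₗ N')
            (fun j => Sum.elim (fun μ => fgrad n' (liftEquiv (τ' μ) ι)) (fun μ => bgrad n' (liftEquiv (τ' μ) ι)) j ∘ₗ (mulOp (fun p : X' × ι => χtX' p.1) ∘ₗ N'))) V'))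
        (Sum.elim (fun μ => fgrad n (liftEquiv (τ μ) ι)) (fun μ => bgrad n (liftEquiv (τ μ) ι)) j ∘ₗ
          (projO none ∘ₗ bgPropV (stack (mulOp (fun p : X × ι => χtX p.1) ∘ₗ N)
            (fun j => Sum.elim (fun μ => fgrad n (liftEquiv (τ μ) ι)) (fun μ => bgrad n (liftEquiv (τ μ) ι)) j ∘ₗ (mulOp (fun p : X × ι => χtX p.1) ∘ₗ N))) V)))
      (fun y y' => ind S y * ind S y' *
        ((((m₀ + oχ * β) + (m₁ + o₁ * β₁ + ct * m₀ + o₂ * β)) * cr +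
              1 * (((m₀ + oχ * β) + (m₁ + o₁ * β₁ + ct * m₀ + o₂ * β)) * cr) * (R * ((β + (β₁ + ct * β)) * (1 - (β + (β₁ + ct * β)) * (R * cr) * cr)⁻¹) * cr) +
            (β + (β₁ + ct * β)) * o * cr * ((β + (β₁ + ct * β)) * (1 - (β + (β₁ + ct * β)) * (R * cr) * cr)⁻¹) * cr) *
          (1 - 1 * ((β + (β₁ + ct * β)) * (R * cr) * cr))⁻¹ * Real.exp (-(ρ₂ * g.dist y y')))) := by
  have hβb : 0 ≤ β + (β₁ + ct * β) := by positivity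
  have hmb : 0 ≤ (m₀ + oχ * β) + (m₁ + o₁ * β₁ + ct * m₀ + o₂ * β) := by positivity
  have hG := hasMaj_smoothCut_flat blk (S := S) hβ hβ₁ hct hχt hsub hcut
  have hD := hasMaj_jet_smoothCut_flat blk τ n (S := S) hβ hβ₁ hct hχt hdχt hdχtb hs hsb hdd hddb hcut hcutF hcutB
  have hG' := hasMaj_smoothCut_flat (blk ∘ π) (S := S) hβ hβ₁ hct hχt' hsub' hcut'
  have hD' := hasMaj_jet_smoothCut_flat (blk ∘ π) τ' n' (S := S) hβ hβ₁ hct hχt' hdχt' hdχtb' hs' hsb' hdd' hddb' hcut' hcutF' hcutB'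
  have hDG := hasMaj_idef_smoothCut_flat blk π (S := S) (N := N) (N' := N') hβ hβ₁ hct hm₀ hm₁ hoχ ho₁ ho₂ hχt' hfitχ hsub hsub' hcut hDcut
  have hDD := hasMaj_idef_jet_smoothCut_flat blk π τ τ' n n' (S := S) (N := N) (N' := N') hβ hβ₁ hct hm₀ hm₁ hoχ ho₁ ho₂ hχt' hdχt' hdχtb' hfit₁ hfit₁b hfit₂ hfit₂b hs hsb hdd hddb
    hs' hsb' hdd' hddb' hcut hcutF hcutB hDcut hDcutF hDcutB
  obtain ⟨hunit, -⟩ := hasMaj_dressedV_pair blk htri hd hrow hσ hβb hR hcr hσρ hρ₁V hρ₁G hρ₂ hρ₂₁ hG hD hV hq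
  obtain ⟨hunit', -⟩ := hasMaj_dressedV_pair (blk ∘ π) htri hd hrow hσ hβb hR hcr hσρ hρ₁V hρ₁G hρ₂ hρ₂₁ hG' hD' hV' hq
  have hψ : mulOp (fun p : X × ι => χX p.1) ∘ₗ (projO (some j) ∘ₗ stack (mulOp (fun p : X × ι => χtX p.1) ∘ₗ N)
      (fun j => Sum.elim (fun μ => fgrad n (liftEquiv (τ μ) ι)) (fun μ => bgrad n (liftEquiv (τ μ) ι)) j ∘ₗ (mulOp (fun p : X × ι => χtX p.1) ∘ₗ N))) =
      projO (some j) ∘ₗ stack (mulOp (fun p : X × ι => χtX p.1) ∘ₗ N)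
        (fun j => Sum.elim (fun μ => fgrad n (liftEquiv (τ μ) ι)) (fun μ => bgrad n (liftEquiv (τ μ) ι)) j ∘ₗ (mulOp (fun p : X × ι => χtX p.1) ∘ₗ N)) := by
    rw [projO_some_comp_stack]; exact jet_smoothCut_out τ n (N := N) hs hsb hdd hddb hs2 hsb2 hdd2 hddb2 j
  have hψf : mulOp (fun p : X' × ι => χX' p.1) ∘ₗ (projO (some j) ∘ₗ stack (mulOp (fun p : X' × ι => χtX' p.1) ∘ₗ N')
      (fun j => Sum.elim (fun μ => fgrad n' (liftEquiv (τ' μ) ι)) (fun μ => bgrad n' (liftEquiv (τ' μ) ι)) j ∘ₗ (mulOp (fun p : X' × ι => χtX' p.1) ∘ₗ N'))) =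
      projO (some j) ∘ₗ stack (mulOp (fun p : X' × ι => χtX' p.1) ∘ₗ N')
        (fun j => Sum.elim (fun μ => fgrad n' (liftEquiv (τ' μ) ι)) (fun μ => bgrad n' (liftEquiv (τ' μ) ι)) j ∘ₗ (mulOp (fun p : X' × ι => χtX' p.1) ∘ₗ N')) := by
    rw [projO_some_comp_stack]; exact jet_smoothCut_out τ' n' (N := N') hs' hsb' hdd' hddb' hs2' hsb2' hdd2' hddb2' j
  have key := hasMaj_idef_projO_dressedV_loc₂ blk π htri hd hrow hσ hcr hβb hR ho hmb hσρ hρ₁V hρ₁G hρ₂ hρ₂₁ (fun _ => rfl) (fun _ => rfl) (some j) hSχ hSψ hSχ' hSψ' hψ (smoothCut_in hNψ)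
    hψf (smoothCut_in hNψ') hG hD hG' hD' hDG hDD hV hV' hDV hq
  rw [projO_some_dressedV (fun _ => rfl) hunit j, projO_some_dressedV (fun _ => rfl) hunit' j] at key
  exact key

end Summit.QuantumFields.YangMills.BalabanUVNodes.N15.CurvedSpecies

end
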